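import Summits.QuantumFields.YangMills.Theorems.UnitScaleTiltHalvingHSiteDatumOfSocketsT
import Summits.QuantumFields.YangMills.Theorems.UnitScaleTiltHalvingHSiteRawP5BaseOfLeaf
import Summits.QuantumFields.YangMills.Theorems.UnitScaleTiltHalvingP1FlatCoreSupplierDatumTrace
import Literature.MathematicalPhysics.QuantumFieldTheory.Balaban1983to89.B8SpecialLinearTrace
import Literature.MathematicalPhysics.QuantumFieldTheory.Balaban1983to89.B8SpecialUnitaryTrace
import HarnessLib

/-!
# `hP1room` PROGRAMME (LEAD-H BOARD v5 «H = hSockets₁′ ∧ hSockets₂′», LEAD-H g5 `LOCATE-K-SOCK` «the row AFTER (K-final)»), ROW (K-sock) FILE B: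
# ★★★ THE GUARDED THEOREM-4 SOCKET `hT4T` OF ✓p667955 FROM THE [4] LETTERS AT EVERY TRUNCATION + THE b9 EDGE AT EVERY LEVEL (+ the raw (1.59) socket), AT `M₂(ℂ)`, `SU(2) ≤ SL(2, ℂ)`

Route `UnitScaleTilt`, crux K1 child «MinimiserStabilityRegPr» (stmt-QuantumFields-19200), registered stub `stub_halvingStep` (`BirthV10`).  Cell `ym3-torus` (HUMAN RULING
D-0037: YM₃ on T³ is ladder rung R3 — NOT d = 4, NOT a mass gap, NOT the Clay problem), width seat `ym-ust-19200-w3` gen 9.  `--supports stmt-QuantumFields-19200 --as helper`;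
THEOREMS ONLY (0 `def`, 0 `sorry`); count-neutral; nothing here claims `hMember`, `hSupUρ4`, the stub, the crux or the gap.

WHY.  BOARD v5 (✓p673445 `hSupUρ4_of_sockets`) displays on the step side `hT4TL ∧ SB9L ∧ SLetτL ∧ H59TL`; `hT4TL` = [Balaban1985RegularSpaces] Theorem 4's datum for `U′ := pull (U^{gJ})♯ 0` at every
level, ∀ `gJ`-closed under J3's four rows — per member exactly ✓p667955 §1's socket `hT4T`, reduced by ✓p667955 §2 `hT4T_of_rawSockets` to the three raw sockets `hP5base hP5 H59` (Prop. 5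
base∕step, (1.59)).  FILES A∕A′ (✓`HalvingHSiteRawP5OfLeaf`, ✓`HalvingHSiteRawP5BaseOfLeaf`) serve `hP5`∕`hP5base` in `G`-form at N05's cube member from the [4] letters + the b9 edge (lit ✓`sockHFP(₀)_body_of_join_RD_traceFree`);
THIS FILE instantiates it at `𝔸 := M₂(ℂ)`, `τ := tr`, `G := SU(2) ≤ H := SL(2, ℂ)` (lit ✓`B8SpecialLinearTrace`: (H2) `trCLM_mlog_eq_zero_of_mem_slUnits`, (H3) `expUnit_mem_slUnits`,
`avgClosed_specialUnitary`; (G3) lit ✓`B8SpecialUnitaryTrace.gaugeExp_mem_specialUnitaryUnits` — exactly as ✓p662594 does for the top step) and composes with ✓p667955 §2: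
* §1 ★★★ `hT4T_of_leafSockets` — CONCLUSION = ✓p667955 §1's socket `hT4T` VERBATIM; HYPOTHESES = ✓p667955 §2's member∕window binders (with `α₄ := 8B₀′c⋆` pinned, `B₀ > 0`) + the
  [4] letters-with-`τ`-laws package `SLetτAll` at EVERY truncation `n′ ≤ K − n` (✓p654110's `SLetτ` shape) + the b9 edge `SB9all` at EVERY level `m ≤ K − n` (lit `SockB9P3`) + the
  JOIN's windows `hwin` (lit ✓`hfpWindows_of_guard`'s conjunction) + the raw (1.59) socket `H59` as in ✓p667955 §2.  The `U′`-rows `s ≤ α₁` feed FILE A's tower row.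
WHAT IT BUYS (LEAD-H's ∕ ★★OWNER's call — a BOARD v6 candidate): with this file the step display can read `SLetτAllL ∧ SB9AllL ∧ H59TL` — [4] Thm 3.1 ∕ (3.25) letters and the b9 ∕ (1.59)
edges ONLY, nothing of [Balaban1985RegularSpaces] (Theorem 4 ∕ Proposition 5) displayed; = LEAD-H g5's LOCATE-K-SOCK «RESULT» sentence.
HONEST SCOPE.  By-name plumbing; the letters, the b9 edge, (1.59) and the windows are DISPLAYED hypotheses (N05∕N06 deliverables); nothing of [4], Prop. 3∕5, Theorem 4, `hMember`, the
stub or the crux is proved here.  Rung R3 (YM₃ on T³), NOT Clay; YM gap NOT proved.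

References: T. Bałaban, CMP **99** (1985) 75–102 [Balaban1985RegularSpaces] (Thm 4 p.88, Prop. 5 (1.106)–(1.109) p.94, (1.29) p.81, (1.38) p.82, (1.59) p.86, (1.66) p.87, p.76, p.98);
CMP **99** (1985) 389–434 [Balaban1985BackgroundPropagators] (Thm 3.1 p.397, (3.25) p.394, Thm 3.3 p.398); CMP **98** (1985) 17–51 [Balaban1985Averaging] ((19) p.21, (43) p.24).
-/

set_option autoImplicit false

noncomputable section

open scoped BigOperators Matrix.Norms.L2Operator
open NormedSpace
open Complex (I)

namespace Summit.QuantumFields.YangMills.Theorems.HalvingHSiteT4OfLeafSockets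

open Literature.MathematicalPhysics.QuantumFieldTheory.Balaban1983to89
open Literature.MathematicalPhysics.QuantumFieldTheory.Balaban1983to89.T3ContinuumYM3Torus
open MatrixLog (mlog)
open B5Eq118OneStroke (iterBlockOf)
open B7Prop1Explicit (e expUnit)
open B7Prop1Explicit renaming Site → LSite
open B7Prop2Explicit (unitaryUnits C0 c2' avgIter)
open B7Prop2SpecialUnitary (specialUnitaryUnits mem_specialUnitaryUnits specialUnitaryUnits_le_unitaryUnits)
open B7Prop3Flat (c3)
open B7Prop10General (C6 C4G)
open B7Prop9Flat (C5')
open B7Prop1Local (InBox)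
open B7Eq78Linearization (conjR zdBlocking QprimeIter)
open B7Eq92Concrete (mgauge)
open B8Ineq130 (tlo thi)
open B8Ineq132 (covDerivFwd InAk)
open B8Eq119TwistedAxial (Restr129 InAx bgT)
open B8Eq131Cubes (tLo tHi)
open B8Eq131CubesAdmissible (cubeFam)
open B8CubeMemberZd (cubeLamS cubeLamB)
open B8Eq184Proof (gaugeExp cfgExp)
open B8Eq140Level (SideTouches)
open B8Eq146AExpansion (iEta)
open B8Eq138LandauZd (IsLandau138W covLap QT)
open B7Prop4GeneralLevels (logCovIter linCovIter)
open B8Eq155JBound (Jcur wsup)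
open B8ScaledSupNorm (bondNorm msup)
open B8Ineq125Concrete (C2p)
open B8Eq1117Concrete (XSpace)
open B8LeafModelZd3 (SockB9P3)
open B8Prop5ContractionKLevel (Bd2 Mc Kc)
open B8LambdaSpaceKLevel (wt)
open B8SpecialUnitaryTrace (trCLM trCLM_mul_comm gaugeExp_mem_specialUnitaryUnits)
open B8SpecialLinearTrace (specialUnitaryUnits_le_slUnits trCLM_mlog_eq_zero_of_mem_slUnits expUnit_mem_slUnits avgClosed_specialUnitary)
open B13Inv214OrbitSUN (slUnits)
open B10Eq27TorusAxialLog (pull pull_apply unitsField toUField unitsField_mem_unitaryUnits)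
open HalvingP1FlatCoreSupplierDatumTrace (pull_unitsField_toUField_mem_SU)
open HalvingHSiteDatumOfSocketsT (hT4T_of_rawSockets)
open HalvingHSiteRawP5OfLeaf (rawP5_of_lettersτ_cubeMember)
open HalvingHSiteRawP5BaseOfLeaf (rawP5base_of_lettersτ_cubeMember)

variable (F : T3Family) {n K : ℕ}

/-! ## §1 The guarded Theorem-4 socket `hT4T` from the leaf sockets (letters-τ at every truncation, b9 at every level) + the raw (1.59) socket -/

set_option maxHeartbeats 400000 in
/-- ★★★ **THE GUARDED THEOREM-4 SOCKET `hT4T` OF ✓p667955 FROM THE [4] LETTERS AT EVERY TRUNCATION + THE b9 EDGE AT EVERY LEVEL + THE RAW (1.59) SOCKET** — conclusion = ✓p667955 §1's `hT4T`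
VERBATIM (∀ `gJ` under J3's four rows, ∀ `m ≤ K − n`: `u` `SU(2)`-valued, (1.29), `W^{u} = U′`, Landau (1.38), chart at size `c⋆`); via ✓p667955 §2 `hT4T_of_rawSockets` with its raw Prop.-5
sockets SERVED by FILE A ✓`rawP5base_of_lettersτ_cubeMember` ∕ ✓`rawP5_of_lettersτ_cubeMember` at `M₂(ℂ)`, `tr`, `SU(2) ≤ SL(2, ℂ)` (lit ✓`B8SpecialLinearTrace`, (G3) lit
✓`gaugeExp_mem_specialUnitaryUnits`); `U′` is `SU(2)`-valued by ✓p657841 `pull_unitsField_toUField_mem_SU`; the tower row's `< s` feeds FILE A's `< α₁` by `s ≤ α₁`.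
[cite: Balaban1985RegularSpaces, Thm 4 p.88, Prop. 5 (1.106)–(1.109) p.94, (1.59) p.86, (1.66) p.87, p.76, p.98; Balaban1985BackgroundPropagators, Thm 3.1 p.397, (3.25) p.394, Thm 3.3 p.398] -/
theorem hT4T_of_leafSockets (L : ℕ) (hF : F.L = L) (hnK : n < K) (ρ S M M' : ℕ) {ρ' : ℕ} (hρ'def : ρ' = ρ + M + L + S)
    {ε₀ : ℝ} (hε₀ : 0 < ε₀) {s : ℝ} (U : GaugeField (F.P K) 0 (Matrix.specialUnitaryGroup (Fin 2) ℂ)) (x₀ : Site (F.P K) 0)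
    {t : ℤ} {a : LSite (F.P K).d} (hadef : a = fun μ => ((iterBlockOf (K - n) x₀ μ).val : ℤ) - t)
    -- Theorem 4's constants and windows ((τ-D)'s binders VERBATIM at `d := (F.P K).d`, `L := (F.P K).L`, `α₀ := ε₀`, `a := s`)
    {α₁ α₄ B₀ B₀' cstar C₂ : ℝ} (hα₁ : 0 < α₁) (hB₀ : 0 < B₀) (hB₀' : 0 < B₀') (hsα₁ : s ≤ α₁) (hsmall₁ : ((F.P K).d : ℝ) * (F.P K).L * α₁ ≤ 1 / 8)
    (hc : cstar = 5 * (F.P K).d * (F.P K).L * B₀ * (ε₀ + α₁)) (hα₄ : α₄ = 8 * B₀' * (5 * ((F.P K).d : ℝ) * (F.P K).L * B₀) * (ε₀ + α₁))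
    (hs₁ : α₄ ≤ 1 / 84) (hs₂ : (F.P K).L * cstar ≤ 1 / 12) (hsa4 : s ≤ 1 / 4) (hs2c : 2 * s ≤ cstar)
    (hα3 : C0 (F.P K).d * ε₀ ≤ 1 / 3) (hα4 : 4 * ε₀ ≤ c2' (F.P K).d (F.P K).L)
    (h16 : 16 * (2 * ((F.P K).L * cstar) + 8 * α₄) ≤ 1) (hd5 : 5 * (2 * ((F.P K).L * cstar) + 8 * α₄) * (((F.P K).d : ℝ) - 1) ≤ 4)
    (hsmall : Real.exp (4 * (800 * (((F.P K).d : ℝ) + 1) ^ 2 * (((F.P K).d : ℝ) + 4)) * ε₀)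
      * (1 + 8 * (131072 * (((F.P K).d : ℝ) + 1) ^ 2) * (2 * ((F.P K).L * cstar) + 8 * α₄)) ≤ 2)
    (hc₃ : 2 * (2 * ((F.P K).L * cstar) + 8 * α₄) ≤ c3 (F.P K).d (F.P K).L) (hside : 36 * (F.P K).d * B₀ * (2 * ((F.P K).L * cstar) + 8 * α₄) ≤ 1 / 2)
    (h50 : 50 * (F.P K).d * (2 * ((F.P K).L * cstar) + 8 * α₄) ≤ 1)
    (hC₂ : 8 * (131072 * (((F.P K).d : ℝ) + 1) ^ 2) * Real.exp (4 * (800 * (((F.P K).d : ℝ) + 1) ^ 2 * (((F.P K).d : ℝ) + 4)) * ε₀) ≤ C₂)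
    (h61 : 2 * (2 * ((F.P K).L * cstar) + 8 * α₄) ^ 2 + 20 * (F.P K).d * ε₀ * (2 * ((F.P K).L * cstar) + 8 * α₄)
      + 2 * C₂ * (2 * ((F.P K).L * cstar) + 8 * α₄) ^ 2 ≤ ε₀ + α₁)
    -- THE LEAF SOCKETS replacing the raw `hP5base` ∕ `hP5` (Prop. 5): the [4] LETTERS (+ their `τ`-laws at `τ := tr`) AT EVERY TRUNCATION `n′ ≤ K − n` at the flat background on
    -- the member's cube families — lit `SockLettersRD`'s body at `(ε₀, U₀ := 1, n′)` ∧ lit `LettersTau`'s three fields (✓p654110's `SLetτ` shape, there at the top truncation only;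
    -- [4] Thm 3.1 ∕ (3.25), N05∕N06) — and the b9 EDGE lit `SockB9P3` AT EVERY LEVEL `m ≤ K − n` ([4] Thm 3.3 in Prop. 3's frame, N06); both `gJ`-independent (geometry only)
    {B₀'H B₂' BG BR : ℝ} (hB₀'H : 0 < B₀'H) (hB₂' : 0 ≤ B₂') (hBG : 0 ≤ BG) (hBR : 0 ≤ BR)
    (SLetτAll : ∀ n', 1 ≤ n' → n' ≤ K - n →
      ∃ (g Δ : (LSite (F.P K).d → Matrix (Fin 2) (Fin 2) ℂ) →ₗ[ℂ] (LSite (F.P K).d → Matrix (Fin 2) (Fin 2) ℂ))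
        (q : (LSite (F.P K).d → Matrix (Fin 2) (Fin 2) ℂ) →ₗ[ℂ] (ℕ → LSite (F.P K).d → Matrix (Fin 2) (Fin 2) ℂ))
        (qs : (ℕ → LSite (F.P K).d → Matrix (Fin 2) (Fin 2) ℂ) →ₗ[ℂ] (LSite (F.P K).d → Matrix (Fin 2) (Fin 2) ℂ))
        (Aw c : (ℕ → LSite (F.P K).d → Matrix (Fin 2) (Fin 2) ℂ) →ₗ[ℂ] (ℕ → LSite (F.P K).d → Matrix (Fin 2) (Fin 2) ℂ))
        (H' : XSpace (F.P K).d n' (Matrix (Fin 2) (Fin 2) ℂ) →ₗ[ℂ] (LSite (F.P K).d → Matrix (Fin 2) (Fin 2) ℂ)),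
      (∀ x, ∀ y ∈ cubeFam false (F.P K).L a M' ρ' (K - n) 0, (Δ (g x) + qs (Aw (q (g x)))) y = x y) ∧ (∀ f, q (g (g (qs (c (q f))))) = q f) ∧
      (∀ (f : LSite (F.P K).d → Matrix (Fin 2) (Fin 2) ℂ), ∀ x ∈ cubeFam false (F.P K).L a M' ρ' (K - n) 0,
        Δ f x = covLap (((F.L : ℝ)⁻¹) ^ (K - n)) (1 : LSite (F.P K).d → Fin (F.P K).d → (Matrix (Fin 2) (Fin 2) ℂ)ˣ) ((cubeFam false (F.P K).L a M' ρ' (K - n) 0).indicator f) x) ∧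
      (∀ (μ : ℕ → LSite (F.P K).d → Matrix (Fin 2) (Fin 2) ℂ), ∀ x ∈ cubeFam false (F.P K).L a M' ρ' (K - n) 0,
        qs μ x = QT (F.P K).L n' (cubeLamS (F.P K).L a M' ρ' (K - n) n') (1 : LSite (F.P K).d → Fin (F.P K).d → (Matrix (Fin 2) (Fin 2) ℂ)ˣ) μ x) ∧
      (∀ (f : LSite (F.P K).d → Matrix (Fin 2) (Fin 2) ℂ) (j : ℕ), j ≤ n' → ∀ y ∈ cubeLamS (F.P K).L a M' ρ' (K - n) n' j,
        q f j y = QprimeIter (zdBlocking (F.P K).d (F.P K).L) (bgT (F.P K).L (1 : LSite (F.P K).d → Fin (F.P K).d → (Matrix (Fin 2) (Fin 2) ℂ)ˣ)) j f y) ∧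
      (∀ (X : XSpace (F.P K).d n' (Matrix (Fin 2) (Fin 2) ℂ)) (x : LSite (F.P K).d), ‖H' X x‖ ≤ B₀'H * ‖X‖) ∧
      (∀ j, j ≤ n' → ∀ (X : XSpace (F.P K).d n' (Matrix (Fin 2) (Fin 2) ℂ)), ∀ p ∈ {b : LSite (F.P K).d × Fin (F.P K).d | SideTouches (cubeFam false (F.P K).L a M' ρ' (K - n) j) b.1 b.2},
        wt (F.P K).L (((F.L : ℝ)⁻¹) ^ (K - n)) j * ‖covDerivFwd (((F.L : ℝ)⁻¹) ^ (K - n)) (1 : LSite (F.P K).d → Fin (F.P K).d → (Matrix (Fin 2) (Fin 2) ℂ)ˣ) p.2 (H' X) p.1‖ ≤ B₀'H * ‖X‖) ∧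
      (∀ X : XSpace (F.P K).d n' (Matrix (Fin 2) (Fin 2) ℂ), Bd2 (F.P K).L (((F.L : ℝ)⁻¹) ^ (K - n)) n' (cubeFam false (F.P K).L a M' ρ' (K - n))
        (covLap (((F.L : ℝ)⁻¹) ^ (K - n)) (1 : LSite (F.P K).d → Fin (F.P K).d → (Matrix (Fin 2) (Fin 2) ℂ)ˣ) (H' X)) (B₂' * ‖X‖)) ∧
      (∀ (X : XSpace (F.P K).d n' (Matrix (Fin 2) (Fin 2) ℂ)) (x : LSite (F.P K).d), x ∉ cubeFam false (F.P K).L a M' ρ' (K - n) 0 → H' X x = 0) ∧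
      (∀ X Y : XSpace (F.P K).d n' (Matrix (Fin 2) (Fin 2) ℂ), (∀ p, Y p = -star (X p)) → ∀ x, H' Y x = -star (H' X x)) ∧
      (∀ (Y : XSpace (F.P K).d n' (Matrix (Fin 2) (Fin 2) ℂ)) (j : ℕ) (hj : j ≤ n') (y : LSite (F.P K).d), y ∈ cubeLamS (F.P K).L a M' ρ' (K - n) n' j →
        QprimeIter (zdBlocking (F.P K).d (F.P K).L) (bgT (F.P K).L (1 : LSite (F.P K).d → Fin (F.P K).d → (Matrix (Fin 2) (Fin 2) ℂ)ˣ)) j (H' Y) y = Y (⟨j, Nat.lt_succ_of_le hj⟩, y)) ∧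
      (∀ (f : LSite (F.P K).d → Matrix (Fin 2) (Fin 2) ℂ) (r : ℝ), 0 ≤ r → Bd2 (F.P K).L (((F.L : ℝ)⁻¹) ^ (K - n)) n' (cubeFam false (F.P K).L a M' ρ' (K - n)) f r →
        (∀ x, ‖g f x‖ ≤ BG * r) ∧ ∀ j, j ≤ n' → ∀ p ∈ {b : LSite (F.P K).d × Fin (F.P K).d | SideTouches (cubeFam false (F.P K).L a M' ρ' (K - n) j) b.1 b.2},
          wt (F.P K).L (((F.L : ℝ)⁻¹) ^ (K - n)) j * ‖covDerivFwd (((F.L : ℝ)⁻¹) ^ (K - n)) (1 : LSite (F.P K).d → Fin (F.P K).d → (Matrix (Fin 2) (Fin 2) ℂ)ˣ) p.2 (g f) p.1‖ ≤ BG * r) ∧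
      (∀ (f : LSite (F.P K).d → Matrix (Fin 2) (Fin 2) ℂ) (x : LSite (F.P K).d), x ∉ cubeFam false (F.P K).L a M' ρ' (K - n) 0 → g f x = 0) ∧
      (∀ f : LSite (F.P K).d → Matrix (Fin 2) (Fin 2) ℂ, (∀ j, j ≤ n' → ∀ x ∈ cubeFam false (F.P K).L a M' ρ' (K - n) j, IsSelfAdjoint (f x)) → ∀ x, IsSelfAdjoint (g f x)) ∧
      (∀ (f : LSite (F.P K).d → Matrix (Fin 2) (Fin 2) ℂ) (r : ℝ), 0 ≤ r → Bd2 (F.P K).L (((F.L : ℝ)⁻¹) ^ (K - n)) n' (cubeFam false (F.P K).L a M' ρ' (K - n)) f r →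
        Bd2 (F.P K).L (((F.L : ℝ)⁻¹) ^ (K - n)) n' (cubeFam false (F.P K).L a M' ρ' (K - n)) (f - g (qs (c (q (g f))))) (BR * r)) ∧
      (∀ f : LSite (F.P K).d → Matrix (Fin 2) (Fin 2) ℂ, (∀ j, j ≤ n' → ∀ x ∈ cubeFam false (F.P K).L a M' ρ' (K - n) j, IsSelfAdjoint (f x)) →
        ∀ j, j ≤ n' → ∀ x ∈ cubeFam false (F.P K).L a M' ρ' (K - n) j, IsSelfAdjoint ((f - g (qs (c (q (g f))))) x)) ∧
      (∀ X : XSpace (F.P K).d n' (Matrix (Fin 2) (Fin 2) ℂ), (∀ p, trCLM (Fin 2) (X p) = 0) → ∀ x, trCLM (Fin 2) (H' X x) = 0) ∧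
      (∀ f : LSite (F.P K).d → Matrix (Fin 2) (Fin 2) ℂ, (∀ j, j ≤ n' → ∀ x ∈ cubeFam false (F.P K).L a M' ρ' (K - n) j, trCLM (Fin 2) (f x) = 0) → ∀ x, trCLM (Fin 2) (g f x) = 0) ∧
      (∀ f : LSite (F.P K).d → Matrix (Fin 2) (Fin 2) ℂ, (∀ j, j ≤ n' → ∀ x ∈ cubeFam false (F.P K).L a M' ρ' (K - n) j, trCLM (Fin 2) (f x) = 0) →
        ∀ j, j ≤ n' → ∀ x ∈ cubeFam false (F.P K).L a M' ρ' (K - n) j, trCLM (Fin 2) ((f - g (qs (c (q (g f))))) x) = 0))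
    {B₀β cB9 β : ℝ}
    (SB9all : ∀ m, m ≤ K - n → ∃ len : LSite (F.P K).d → ℝ,
      @SockB9P3 (F.P K).d (Matrix (Fin 2) (Fin 2) ℂ) (B10Eq29TubeLine.cstarAlgebraMatrix 2) (F.P K).L B₀ B₀β cB9 β len (((F.L : ℝ)⁻¹) ^ (K - n)) m
        (cubeFam false (F.P K).L a M' ρ' (K - n)) (cubeLamS (F.P K).L a M' ρ' (K - n)) (cubeLamB (F.P K).L a M' ρ' (K - n)))
    -- THE JOIN's SCALAR WINDOWS at `(ε₀, α₁)` as ONE conjunction — letter for letter the conclusion of lit ✓`B8SockHFPWindows.hfpWindows_of_guard` at `d := 3`, `L := F.L` (served below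
    -- ONE threshold `cP(L, B₀, B₀′, B₀′_H, B₂′, B_G, B_R, c_{b9})` on `ε₀ + α₁` under `3·(2dL²)·B_G·B_R ≤ B₀′`; §3)
    (hwin : ∀ cs α₄' cB cDA hE hE₂ lE lE₂ : ℝ, cs = 5 * ((F.P K).d : ℝ) * (F.P K).L * B₀ * (ε₀ + α₁) → α₄' = 8 * B₀' * (5 * ((F.P K).d : ℝ) * (F.P K).L * B₀) * (ε₀ + α₁) →
      cB = (F.P K).L * cs → cDA = 2 * ((F.P K).d : ℝ) * ((F.P K).L : ℝ) ^ 2 * cs →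
      hE = B₀'H * (C2p (F.P K).d * (40 * (F.P K).d * cB + α₄') * α₄') → hE₂ = B₂' * (C2p (F.P K).d * (40 * (F.P K).d * cB + α₄') * α₄') →
      lE = B₀'H * (4 * C2p (F.P K).d * (40 * (F.P K).d * cB + 2 * α₄')) → lE₂ = B₂' * (4 * C2p (F.P K).d * (40 * (F.P K).d * cB + 2 * α₄')) →
      36 * (F.P K).d * B₀ * cs ≤ 1 / 2 ∧
      8 * (131072 * (((F.P K).d : ℝ) + 1) ^ 2) * Real.exp (4 * (800 * (((F.P K).d : ℝ) + 1) ^ 2 * (((F.P K).d : ℝ) + 4)) * ε₀) ≤ 16 * (131072 * (((F.P K).d : ℝ) + 1) ^ 2) ∧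
      2 * cs ^ 2 + 20 * (F.P K).d * ε₀ * cs + 2 * (16 * (131072 * (((F.P K).d : ℝ) + 1) ^ 2)) * cs ^ 2 ≤ ε₀ + α₁ ∧
      ((F.P K).d : ℝ) * (F.P K).L * α₁ ≤ 1 / 8 ∧
      ε₀ ≤ cB9 ∧ cs ≤ cB9 ∧
      C0 (F.P K).d * ε₀ ≤ 1 / 3 ∧ 4 * ε₀ ≤ c2' (F.P K).d (F.P K).L ∧
      Real.exp (4 * (800 * (((F.P K).d : ℝ) + 1) ^ 2 * (((F.P K).d : ℝ) + 4)) * ε₀) * (1 + 8 * (131072 * (((F.P K).d : ℝ) + 1) ^ 2) * cB) ≤ 2 ∧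
      2 * cB ≤ c3 (F.P K).d (F.P K).L ∧ 2048 * ((F.P K).d : ℝ) * cB ≤ 1 ∧ 40 * (F.P K).d * cB ≤ 1 / 200 ∧
      200 * C6 (F.P K).d * (2 * α₄') ≤ 1 ∧ 12000 * (((F.P K).d : ℝ) + 1) * (F.P K).L * (2 * α₄') ≤ 1 ∧
      C4G (F.P K).d (F.P K).L * (ε₀ + 40 * (F.P K).d * cB + 4 * (2 * α₄')) ≤ 1 ∧
      1024 * (((F.P K).d : ℝ) + 1) * (((F.P K).d : ℝ) + 4) * (F.P K).L ^ 2 * ε₀ ≤ 1 ∧ 32 * (((F.P K).d : ℝ) + 1) ^ 2 * C6 (F.P K).d * (F.P K).L ^ 2 * ε₀ ≤ 1 ∧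
      16 * (F.P K).d * C5' (F.P K).d * C6 (F.P K).d * ((F.P K).L : ℝ) ^ 2 * ε₀ ≤ 1 ∧ 8 * (F.P K).d * C6 (F.P K).d * (F.P K).L * ε₀ ≤ 1 ∧
      40 * (F.P K).d * cB + α₄' ≤ 1 / (4 * B₀'H * (2 * C2p (F.P K).d)) ∧ 2 * C6 (F.P K).d * (40 * (F.P K).d * cB + 4 * α₄') ≤ 1 / 8 ∧
      cB ≤ 1 / 13 ∧ α₄' / 4 + hE ≤ 1 / 24 ∧ α₄' / 4 + hE ≤ 1 / 140 ∧ 10 * (α₄' / 4 + hE) * BR ≤ 1 / 2 ∧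
      BG * Mc (F.P K).d BR (α₄' / 4 + hE) cB hE₂ cDA ≤ α₄' / 4 ∧
      BG * Kc (F.P K).d BR (α₄' / 4 + hE) cB hE₂ cDA lE₂ (1 + lE) (1 + lE) ≤ 1 / 2)
    -- the raw (1.59) socket in Theorem 4's frame ([4] Thm 3.3), ∀ `gJ`-closed under J3's three rows — ✓p667955 §2's `H59` VERBATIM (v6a; §2 derives it from `SB9all`)
    (H59 : ∀ gJ : GaugeTransf (F.P K) 0 (Matrix.specialUnitaryGroup (Fin 2) ℂ),
      InAk (F.P K).L (K - n) (((F.L : ℝ)⁻¹) ^ (K - n)) ε₀ (fun _ => (Set.univ : Set (LSite (F.P K).d))) (pull (unitsField (toUField (GaugeField.gaugeAct gJ U))) 0) →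
      (∀ m', m' ≤ K - n → ∀ Λ : ℕ → Set (LSite (F.P K).d),
        InAx (F.P K).L m' Λ (1 : LSite (F.P K).d → Fin (F.P K).d → (Matrix (Fin 2) (Fin 2) ℂ)ˣ) (pull (unitsField (toUField (GaugeField.gaugeAct gJ U))) 0)) →
      (∀ m', m' ≤ K - n → ∀ (x : LSite (F.P K).d) (ν : Fin (F.P K).d), tlo (F.P K).L (tLo a ρ') m' ≤ x → x + e ν ≤ thi (F.P K).L (tHi a M' ρ') m' →
        ‖((avgIter (F.P K).L (pull (unitsField (toUField (GaugeField.gaugeAct gJ U))) 0) (K - n - m') x ν : (Matrix (Fin 2) (Fin 2) ℂ)ˣ) :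
            Matrix (Fin 2) (Fin 2) ℂ) - 1‖ < s) →
      ∀ m, 1 ≤ m → m ≤ K - n → ∀ (u : LSite (F.P K).d → (Matrix (Fin 2) (Fin 2) ℂ)ˣ) (W : LSite (F.P K).d → Fin (F.P K).d → (Matrix (Fin 2) (Fin 2) ℂ)ˣ) (A' : LSite (F.P K).d → Fin (F.P K).d → (Matrix (Fin 2) (Fin 2) ℂ)),
      (∀ x, u x ∈ unitaryUnits (Matrix (Fin 2) (Fin 2) ℂ)) → mgauge (1 : LSite (F.P K).d → Fin (F.P K).d → (Matrix (Fin 2) (Fin 2) ℂ)ˣ) u W = (pull (unitsField (toUField (GaugeField.gaugeAct gJ U))) 0) → Restr129 (F.P K).L m ((cubeLamS (F.P K).L a M' ρ' (K - n)) m) (1 : LSite (F.P K).d → Fin (F.P K).d → (Matrix (Fin 2) (Fin 2) ℂ)ˣ) u → IsLandau138W (F.P K).L m (((F.L : ℝ)⁻¹) ^ (K - n)) ((cubeFam false (F.P K).L a M' ρ' (K - n)) 0) ((cubeLamS (F.P K).L a M' ρ' (K - n)) m) (1 : LSite (F.P K).d → Fin (F.P K).d → (Matrix (Fin 2) (Fin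 2) ℂ)ˣ) W →
      (∀ y τ, IsSelfAdjoint (A' y τ)) →
      (∀ j, j ≤ m → ∀ y τ, SideTouches ((cubeFam false (F.P K).L a M' ρ' (K - n)) j) y τ →
        W y τ = cfgExp (((F.L : ℝ)⁻¹) ^ (K - n)) A' y τ ∧ ‖A' y τ‖ ≤ (2 * ((F.P K).L * cstar) + 8 * α₄) * (((F.P K).L : ℝ) ^ j * (((F.L : ℝ)⁻¹) ^ (K - n)))⁻¹) →
      (∀ y τ, (∀ j, j ≤ m → ¬ SideTouches ((cubeFam false (F.P K).L a M' ρ' (K - n)) j) y τ) → A' y τ = 0) →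
      msup (F.P K).L m (((F.L : ℝ)⁻¹) ^ (K - n)) (-(1 : ℝ)) (fun j (b : LSite (F.P K).d × Fin (F.P K).d) => SideTouches ((cubeFam false (F.P K).L a M' ρ' (K - n)) j) b.1 b.2) (fun b => A' b.1 b.2)
          ≤ B₀ * (bondNorm (F.P K).L m (((F.L : ℝ)⁻¹) ^ (K - n)) (-(3 : ℝ)) (cubeFam false (F.P K).L a M' ρ' (K - n)) (fun x μ => Jcur (((F.L : ℝ)⁻¹) ^ (K - n)) (1 : LSite (F.P K).d → Fin (F.P K).d → (Matrix (Fin 2) (Fin 2) ℂ)ˣ) A' μ x)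
            + wsup 1 (fun p : {p : ℕ × (LSite (F.P K).d × Fin (F.P K).d) // p.1 ≤ m ∧ p.2 ∈ (cubeLamB (F.P K).L a M' ρ' (K - n)) m p.1} =>
                linCovIter (F.P K).L (1 : LSite (F.P K).d → Fin (F.P K).d → (Matrix (Fin 2) (Fin 2) ℂ)ˣ) (iEta (((F.L : ℝ)⁻¹) ^ (K - n)) A') p.1.1 p.1.2.1 p.1.2.2)) ∧
        msup (F.P K).L m (((F.L : ℝ)⁻¹) ^ (K - n)) (-(2 : ℝ)) (fun j (t : Fin (F.P K).d × Fin (F.P K).d × LSite (F.P K).d) => SideTouches ((cubeFam false (F.P K).L a M' ρ' (K - n)) j) t.2.2 t.2.1)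
            (fun t => covDerivFwd (((F.L : ℝ)⁻¹) ^ (K - n)) (1 : LSite (F.P K).d → Fin (F.P K).d → (Matrix (Fin 2) (Fin 2) ℂ)ˣ) t.1 (fun z => A' z t.2.1) t.2.2)
          ≤ B₀ * (bondNorm (F.P K).L m (((F.L : ℝ)⁻¹) ^ (K - n)) (-(3 : ℝ)) (cubeFam false (F.P K).L a M' ρ' (K - n)) (fun x μ => Jcur (((F.L : ℝ)⁻¹) ^ (K - n)) (1 : LSite (F.P K).d → Fin (F.P K).d → (Matrix (Fin 2) (Fin 2) ℂ)ˣ) A' μ x)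
            + wsup 1 (fun p : {p : ℕ × (LSite (F.P K).d × Fin (F.P K).d) // p.1 ≤ m ∧ p.2 ∈ (cubeLamB (F.P K).L a M' ρ' (K - n)) m p.1} =>
                linCovIter (F.P K).L (1 : LSite (F.P K).d → Fin (F.P K).d → (Matrix (Fin 2) (Fin 2) ℂ)ˣ) (iEta (((F.L : ℝ)⁻¹) ^ (K - n)) A') p.1.1 p.1.2.1 p.1.2.2))) :
    ∀ gJ : GaugeTransf (F.P K) 0 (Matrix.specialUnitaryGroup (Fin 2) ℂ),
      InAk (F.P K).L (K - n) (((F.L : ℝ)⁻¹) ^ (K - n)) ε₀ (fun _ => (Set.univ : Set (LSite (F.P K).d))) (pull (unitsField (toUField (GaugeField.gaugeAct gJ U))) 0) →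
      (∀ m', m' ≤ K - n → ∀ Λ : ℕ → Set (LSite (F.P K).d),
        InAx (F.P K).L m' Λ (1 : LSite (F.P K).d → Fin (F.P K).d → (Matrix (Fin 2) (Fin 2) ℂ)ˣ) (pull (unitsField (toUField (GaugeField.gaugeAct gJ U))) 0)) →
      (∀ m', m' ≤ K - n → ∀ (x : LSite (F.P K).d) (ν : Fin (F.P K).d), tlo (F.P K).L (tLo a ρ') m' ≤ x → x + e ν ≤ thi (F.P K).L (tHi a M' ρ') m' →
        ‖((avgIter (F.P K).L (pull (unitsField (toUField (GaugeField.gaugeAct gJ U))) 0) (K - n - m') x ν : (Matrix (Fin 2) (Fin 2) ℂ)ˣ) :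
            Matrix (Fin 2) (Fin 2) ℂ) - 1‖ < s) →
      (∀ (x : LSite (F.P K).d) (ν : Fin (F.P K).d), tlo (F.P K).L (tLo a ρ') (K - n) ≤ x → x + e ν ≤ thi (F.P K).L (tHi a M' ρ') (K - n) →
        ‖((pull (unitsField (toUField (GaugeField.gaugeAct gJ U))) 0 x ν : (Matrix (Fin 2) (Fin 2) ℂ)ˣ) : Matrix (Fin 2) (Fin 2) ℂ) - 1‖ < s) →
      ∀ m, m ≤ K - n → ∃ u : LSite (F.P K).d → (Matrix (Fin 2) (Fin 2) ℂ)ˣ, (∀ x, ((u x : (Matrix (Fin 2) (Fin 2) ℂ)ˣ) : Matrix (Fin 2) (Fin 2) ℂ) ∈ Matrix.specialUnitaryGroup (Fin 2) ℂ) ∧ Restr129 (F.P K).L m ((cubeLamS (F.P K).L a M' ρ' (K - n)) m) (1 : LSite (F.P K).d → Fin (F.P K).d → (Matrix (Fin 2) (Fin 2) ℂ)ˣ) u ∧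
      ∃ W : LSite (F.P K).d → Fin (F.P K).d → (Matrix (Fin 2) (Fin 2) ℂ)ˣ, mgauge (1 : LSite (F.P K).d → Fin (F.P K).d → (Matrix (Fin 2) (Fin 2) ℂ)ˣ) u W = (pull (unitsField (toUField (GaugeField.gaugeAct gJ U))) 0) ∧ (1 ≤ m → IsLandau138W (F.P K).L m (((F.L : ℝ)⁻¹) ^ (K - n)) ((cubeFam false (F.P K).L a M' ρ' (K - n)) 0) ((cubeLamS (F.P K).L a M' ρ' (K - n)) m) (1 : LSite (F.P K).d → Fin (F.P K).d → (Matrix (Fin 2) (Fin 2) ℂ)ˣ) W) ∧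
        ∃ A : LSite (F.P K).d → Fin (F.P K).d → (Matrix (Fin 2) (Fin 2) ℂ), ∀ j, j ≤ m → ∀ b ∈ {b : LSite (F.P K).d × Fin (F.P K).d | SideTouches ((cubeFam false (F.P K).L a M' ρ' (K - n)) j) b.1 b.2},
          W b.1 b.2 = cfgExp (((F.L : ℝ)⁻¹) ^ (K - n)) A b.1 b.2 ∧ IsSelfAdjoint (A b.1 b.2) ∧ ‖A b.1 b.2‖ ≤ cstar * (((F.P K).L : ℝ) ^ j * (((F.L : ℝ)⁻¹) ^ (K - n)))⁻¹  := by
  letI : CStarAlgebra (Matrix (Fin 2) (Fin 2) ℂ) := B10Eq29TubeLine.cstarAlgebraMatrix 2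
  intro gJ hInAk hInAx htw hfine
  have hd2 : 2 ≤ (F.P K).d := by rw [T3Family.P_d F K]; norm_num
  have hL2 : 2 ≤ (F.P K).L := (F.P K).hL.2
  have hη : 0 < ((F.L : ℝ)⁻¹) ^ (K - n) := by
    have hL0 : (0 : ℝ) < F.L := by exact_mod_cast (F.P K).L_pos
    positivity
  have hk : 1 ≤ K - n := by omega
  have hρL : (F.P K).L ≤ ρ' := by
    have hLF : (F.P K).L = F.L := rfl
    rw [hLF, hF, hρ'def]; omega
  have hα₄0 : 0 ≤ α₄ := by
    rw [hα₄]
    have : 0 ≤ ε₀ + α₁ := by linarith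
    positivity
  -- (G3) for `SU(2)`: Hermitian trace-free `λ` exponentiates into `SU(2)`
  have hG3 : ∀ lam : LSite (F.P K).d → Matrix (Fin 2) (Fin 2) ℂ, (∀ x, IsSelfAdjoint (lam x)) → (∀ x, trCLM (Fin 2) (lam x) = 0) →
      ∀ x, gaugeExp lam x ∈ specialUnitaryUnits (Fin 2) := fun lam hsa htr x => gaugeExp_mem_specialUnitaryUnits hsa htr x
  refine hT4T_of_rawSockets F L hF ρ S M M' hρ'def hε₀ U x₀ hadef hα₁ hα₄0 hB₀.le hsα₁ hsmall₁ hc hs₁ hs₂ hsa4 hs2c hα3 hα4 h16 hd5 hsmall hc₃ hside h50 hC₂ h61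
    ?_ ?_ H59 gJ hInAk hInAx htw hfine
  · -- the raw BASE socket from the letters at truncation `1` (FILE A §3)
    intro gJ' hInAk' hInAx' htw'
    have hU'G' : ∀ (x : LSite (F.P K).d) (κ : Fin (F.P K).d),
        pull (unitsField (toUField (GaugeField.gaugeAct gJ' U))) 0 x κ ∈ specialUnitaryUnits (Fin 2) :=
      fun x κ => mem_specialUnitaryUnits.2 (pull_unitsField_toUField_mem_SU (GaugeField.gaugeAct gJ' U) 0 x κ)
    -- (1.66) at size `s` on the collar at depth `K − n` = the tower row (d) at `m′ := K − n` (`Ū⁰ = U′`); `2s ≤ c⋆` is Theorem 4's window `hs2c`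
    have hfine' : ∀ (x : LSite (F.P K).d) (ν : Fin (F.P K).d), tlo (F.P K).L (tLo a ρ') (K - n) ≤ x → x + e ν ≤ thi (F.P K).L (tHi a M' ρ') (K - n) →
        ‖((pull (unitsField (toUField (GaugeField.gaugeAct gJ' U))) 0 x ν : (Matrix (Fin 2) (Fin 2) ℂ)ˣ) : Matrix (Fin 2) (Fin 2) ℂ) - 1‖ < s := by
      intro x ν h1 h2
      have h := htw' (K - n) le_rfl x ν h1 h2
      rwa [Nat.sub_self, B7Prop2Explicit.avgIter_zero] at h
    have hs2c' : 2 * s ≤ 5 * ((F.P K).d : ℝ) * (F.P K).L * B₀ * (ε₀ + α₁) := by rw [← hc]; exact hs2c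
    have h := rawP5base_of_lettersτ_cubeMember (𝔸 := Matrix (Fin 2) (Fin 2) ℂ) (trCLM (Fin 2)) (trCLM_mul_comm (n := Fin 2)) hd2 hL2 hη hk
      (G := specialUnitaryUnits (Fin 2)) (H := slUnits 2)
      (fun g hg hs => trCLM_mlog_eq_zero_of_mem_slUnits (by norm_num) hg hs) (fun S hS => expUnit_mem_slUnits hS)
      (avgClosed_specialUnitary (F.P K).d (F.P K).L (N := 2) (by norm_num)) specialUnitaryUnits_le_slUnits specialUnitaryUnits_le_unitaryUnits hG3
      a M' hρL rfl rfl rfl hε₀ hα₁ hB₀ hB₀' hU'G' hInAk' hInAx' SB9all hs2c' hfine' hB₀'H hB₂' hBG hBR SLetτAll hwin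
    rw [hα₄]
    exact h
  · -- the raw STEP socket from the letters at truncation `m + 1` and the b9 edge at level `m` (FILE A §2)
    intro gJ' hInAk' hInAx' htw'
    have htwα' : ∀ m', m' ≤ K - n → ∀ (x : LSite (F.P K).d) (ν : Fin (F.P K).d), tlo (F.P K).L (tLo a ρ') m' ≤ x → x + e ν ≤ thi (F.P K).L (tHi a M' ρ') m' →
        ‖((avgIter (F.P K).L (pull (unitsField (toUField (GaugeField.gaugeAct gJ' U))) 0) (K - n - m') x ν : (Matrix (Fin 2) (Fin 2) ℂ)ˣ) :
            Matrix (Fin 2) (Fin 2) ℂ) - 1‖ < α₁ :=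
      fun m' hm' x ν h1 h2 => lt_of_lt_of_le (htw' m' hm' x ν h1 h2) hsα₁
    have hU'G' : ∀ (x : LSite (F.P K).d) (κ : Fin (F.P K).d),
        pull (unitsField (toUField (GaugeField.gaugeAct gJ' U))) 0 x κ ∈ specialUnitaryUnits (Fin 2) :=
      fun x κ => mem_specialUnitaryUnits.2 (pull_unitsField_toUField_mem_SU (GaugeField.gaugeAct gJ' U) 0 x κ)
    have h := rawP5_of_lettersτ_cubeMember (𝔸 := Matrix (Fin 2) (Fin 2) ℂ) (trCLM (Fin 2)) (trCLM_mul_comm (n := Fin 2)) hd2 hL2 hη (k := K - n)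
      (G := specialUnitaryUnits (Fin 2)) (H := slUnits 2)
      (fun g hg hs => trCLM_mlog_eq_zero_of_mem_slUnits (by norm_num) hg hs) (fun S hS => expUnit_mem_slUnits hS)
      (avgClosed_specialUnitary (F.P K).d (F.P K).L (N := 2) (by norm_num)) specialUnitaryUnits_le_slUnits specialUnitaryUnits_le_unitaryUnits hG3
      a M' hρL rfl rfl rfl hε₀ hα₁ hB₀ hB₀' hU'G' hInAk' hInAx' htwα' SB9all hB₀'H hB₂' hBG hBR SLetτAll hwin
    rw [hc, hα₄]
    exact h

end Summit.QuantumFields.YangMills.Theorems.HalvingHSiteT4OfLeafSockets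

end
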